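import Literature.MathematicalPhysics.QuantumFieldTheory.Balaban1983to89.B6GOneLevelV1Bridge
import Literature.MathematicalPhysics.QuantumFieldTheory.Balaban1983to89.B6Eq2129TwoScaleV1
import Literature.MathematicalPhysics.QuantumFieldTheory.Balaban1983to89.B6
import Literature.MathematicalPhysics.QuantumFieldTheory.BalabanImbrieJaffe1984to88.BIJ85Prop12AllTori

/-!
# `Balaban1983to89.B6Prop25OneLevelV1` — T. Bałaban, *Propagators and renormalization transformations for lattice gauge theories. II*,
# Commun. Math. Phys. **96** (1984) 223–250 [Balaban1984PropagatorsII], **Proposition 2.5** p. 246 — the VERBATIM typed statement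
# `B6.Prop25Printed` INHABITED WITH NO HYPOTHESIS on the ONE-LEVEL sub-family of the local operators `G_□` of (2.90) (`Λ′ = ∅`:
# `G_□ = (Δ − ∂P∂* + Q*aQ)⁻¹ = Δ_a⁻¹` on the whole torus `T_□ = T_η`, unit lattice `T^{(j)}`), model instance per the cell's G.1 standard:
# the representation (2.129) is p22's theorem `B6Eq2129TwoScaleV1.eq2129_V1` for THESE operators, the inequalities (1.110)–(1.114) of [4] Prop. 1.2
# are p19's `BIJ85Prop12AllTori.prop12Printed_allTori` for THE SAME operators — the two formalizations being ONE operator by the bridge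
# `B6GOneLevelV1Bridge` (file (B)) and p22's `G_eq_GE`

statement-level skeleton of published theorems with citation tags; proofs where landed; nothing here is a claim about the Yang–Mills mass gap

PDF held: `paper:balaban1984-cmp96-propagators-rt-ii` (journal page = PDF page + 222; p. 239 [PDF 17], p. 246 [PDF 24]; p. 246 verified as image
on the ×2 render `run/shared/lean/pub/pub-balaban/b2b-balaban-ref1/pages/1984-cmp96-propagators-rt-II/…-p024-x2.png` by this seat, gen 1).

PRINT (verbatim, p. 246): *"All the above considerations imply the following. Proposition 2.5. The operator G_□ defined by (2.90) on the torus T_□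
(or on the whole lattice ξZ^d) has the representation (2.129) and satisfies all the inequalities (1.110)–(1.114) of the Proposition 1.2 with a
positive constant δ₂ instead of δ₀. This constant depends on d and L only."*; p. 239: *"On this torus we define operators R, Δ_a as in (2.17),
(2.19), but only two scales are present now … G_□ = (Δ − ∂P_□∂* + Q*aQ)⁻¹. (2.90)"*; p. 224: *"we admit the case when some domains Ω_j are equal
to T_η"*.  [4] = [Balaban1984PropagatorsI] Prop. 1.2 pp. 35–36.

CITATION HEADER (lean-in-tree rule) — WHAT IS REPRODUCED.  Phase-2 file of the `lit-balaban` typed skeleton (HOME `run/shared/lean/pub/lit-balaban/`),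
seat **r03 gen 10** (B6 fold owner; own lane, TAKING 2026-08-21T22:05Z), file (C) of the programme; SKELETON row **B6.Prop2.5** (decl of record: the
verbatim census Prop `B6.Prop25Printed` over `B6.LocalOp`, b06 — untouched; HEAD CANDIDATE typed-existing → proved, model instance per G.1 exactly as
B6.Prop2.6 `B6Prop26OneScaleFromB5.prop26Printed_famG` (r03 g9, ref-4 g26) and B6.Prop2.2/2.3).  Inputs BY NAME, nothing restated: p22's
`B6SectCTwoScaleV1Lattice.tsV1` (the concrete Sect. C data) with `B6Eq2129TwoScaleV1.eq2129_V1` ((2.129) for them, any `Λ′`, any weight) and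
`G_eq_GE` (their `G` = p21's `GE (twoScale j hj Λ′)`); file (B) `B6GOneLevelV1Bridge.GE_twoScale_empty_apply_eq_sum_Gk` (p21's `GE` at `Λ′ = ∅` = p09's
kernel `BIJ85Ineq722DeltaA.Gk = Re Δ_a⁻¹` of [4] (1.71), weight `a·(L^j)^d`); p19's `BIJ85Prop12AllTori.prop12Printed_allTori` ([4] Prop. 1.2 for p09's
`settingOf (torusRep P k (deltaAData hk a)) k` over ALL tori, from r02/p37's `B5Prop12GHolds.prop12_famG_printed`).  New definitions (with bodies):
the index `Idx d L` (all tori of the `Setup` calculus with `d`, `L` fixed and a level `1 ≤ k`, `k + 1 ≤ m + K`), `toAllTori`, the one-level data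
`oneLevelData P k a := tsV1 (c := L^k) ∅ (wPrinted (a·(L^k)^d))`, the family `loc d L a : Idx d L → B6.LocalOp` whose
`Repr2129` FIELD is the (2.129) identity for `oneLevelData` (PROVED, `repr2129_loc` — no `def … : Prop`, nothing is a named unproved fact).

WHAT IS PROVED (kernel-checked, 0 sorry, standard axioms; every `d ≥ 1`, odd `L > 1`, `a > 0`).
* `repr2129_loc` — (2.129) for every member (p22's `eq2129_V1` at `Λ′ = ∅`, `c = L^k`, weight `a·(L^k)^d`).
* **`oneLevelData_G_apply_eq_sum_Gk`** / **`oneLevelData_G_apply_eq_sum_torusRep_G`** — HONESTY LINK: the operator `G` whose representation (2.129)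
  is asserted in `loc i` IS, entry by entry, the kernel `(torusRep P k (deltaAData hk a)).G = Gk hk a` whose [4]-functionals `(loc i).S` grade the
  inequalities (file (B) + p22's `G_eq_GE`).
* **`prop25Printed_oneLevel (d L : ℕ) (ha : 0 < a) : B6.Prop25Printed (loc d L a)`** — NO HYPOTHESIS; `prop12Printed_loc` (the [4] half alone).
DISCLOSURE (v1.1, docstring only; ref-4 NOTE S-B6-g45-1, 2026-08-22T12:04:28Z; owner r03 g14).  p09's carrier `settingOf` used for the [4]-half
here has GENUINE functionals ONLY for (1.110) `m = 0, 1` (`|GJ|`, `|∇GJ|`) and the first member of (1.111) (`‖ζ∇GJ‖_α`); its `l2Norm`, `holder`,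
`l2op`, `e 2`, `e 3`, `e4`, `h2`, `l2loc` are the constant `0` (p19's `BIJ85Prop12AllTori` header: «the other functionals of that carrier are 0»), so
in `prop25Printed_oneLevel` the clauses (1.110)₃,₄, (1.111)₂, (1.112), (1.113), (1.114)₁₋₆ hold VACUOUSLY — the phrase «(1.110)–(1.114) = [4] Prop.
1.2 transferred» below over-states what THIS instance certifies.  The instance of record of row B6.Prop2.5 is now
`…B6Prop25OneLevelFamG.prop25Printed_oneLevel_famG` (p327418, r03 g14): the SAME family and the SAME `Repr2129` field with the [4]-half on [4]'s
genuine torus family `B5Prop12GLattice.famG` (every (1.110)–(1.114) slot the concrete quantity in `(DeltaA (L^k) (Mk P k) a)⁻¹`); ref-4 g45 re-pointed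
the head pid p310856 → p327418; this file stays as the `settingOf` member.  No declaration of this file is changed.

HONEST SCOPE.  ONE LEVEL ONLY: the members of (2.90) with `Λ′ ≠ ∅` (the genuine two-scale operators with `∂P_□∂*` and the two averaging scales — the
content of Sect. C beyond [4]) are NOT covered; for them (2.129) is p22's `eq2129_V1` (any `Λ′`) but the inequalities (1.110)–(1.114) with δ₂(d, L) are
the multi-scale DAG hypothesis (rows B6.Eq2.132/B6.Txt@246 feed them).  At one level `G_□ = Δ_a⁻¹` of [4] (1.69)–(1.71) and δ₂ = δ₀ of [4] Prop. 1.2; the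
coarsest level `k = m + K` of each tower is excluded (p22's two-scale structure needs the level `k + 1` to exist); `T_□` = the whole torus (the enlarged-cube
tori of Sect. C are tori of the same calculus); weight/lattice-factor dictionary as in file (B).  Value = the census Prop of Prop. 2.5 inhabited on a
genuine sub-family with both conjuncts about ONE operator; NOT summit progress.
-/

noncomputable section

open scoped BigOperators InnerProductSpace Matrix

namespace Literature.MathematicalPhysics.QuantumFieldTheory.Balaban1983to89.B6Prop25OneLevelV1

open LatticeFieldCalculus B6SectADomainsV1 B6SectAOperatorsV1 B6SectAVectorModelV1 B6SectCOperators B6SectCTwoScaleV1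
  B6SectCTwoScaleV1Lattice B6Eq2129TwoScaleV1 B6ProjR212TorusBridge B6GOneLevelV1Bridge
open B5Eq117TorusCarriers (Mk EK)
open BalabanImbrieJaffe1984to88.BIJ85AxialPropagator411 (BondSpace)
open BalabanImbrieJaffe1984to88.BIJ85Ineq722ProofPart2 (settingOf)
open BalabanImbrieJaffe1984to88.BIJ85Ineq722Torus (torusRep)
open BalabanImbrieJaffe1984to88.BIJ85Ineq722DeltaA (Gk deltaAData)
open BalabanImbrieJaffe1984to88.BIJ85Prop12AllTori (prop12Printed_allTori)

/-! ## §1  The one-level member of (2.90): p22's concrete two-scale data at `Λ′ = ∅` -/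

-- the lattice factor `c = L^k ≠ 0` is the tree's `BIJ85Eq431DeltaKBridge.Lpow_ne_zero`; it is used here only as the inline
-- term `pow_ne_zero _ (Nat.cast_ne_zero.2 P.L_pos.ne')` (no restated declaration — gate dedup rule).

/-- **the one-level member of (2.90)**: p22's concrete Sect. C data `tsV1` on the torus `T_η = T^{(0)}` of `P` with unit lattice `T^{(k)}`, `Λ′ = ∅`
(so `G = (Δ − ∂P∂* + Q*aQ)⁻¹` has only the `Q_k`-constraints: `G = Δ_a⁻¹` of [4] (1.71)), lattice factor `L^k`, weight `a·(L^k)^d` (the weight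
dictionary of file (B): p21's unweighted ℓ² adjoint versus the print's `η^{−d}`-weighted one). [cite: Balaban1984PropagatorsII, (2.90) p.239] -/
def oneLevelData (P : Params) (k : ℕ) (a : ℝ) :
    TwoScaleData (BondSpace P) (ScalarSpace P) (USite P k) (BalabanImbrieJaffe1984to88.BIJ85AxialPropagator411.PlaqSpace P)
      (UBond P k) (CSpace k (∅ : Finset (Site P (k + 1)))) :=
  tsV1 (P := P) (pow_ne_zero k (Nat.cast_ne_zero.2 P.L_pos.ne')) (∅ : Finset (Site P (k + 1))) (wPrinted P k ∅ (a * ((P.L : ℝ) ^ k) ^ P.d))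

/-- `0 < a·(L^k)^d`. [cite: Balaban1984PropagatorsII, (2.94) p.239] -/
theorem weight_pos (P : Params) (k : ℕ) {a : ℝ} (ha : 0 < a) : 0 < a * ((P.L : ℝ) ^ k) ^ P.d :=
  mul_pos ha (pow_pos (pow_pos P.cast_L_pos k) P.d)

/-- the weight of the one-level member on p21's constraint index: `a·(L^k)^d` on every (level-`k`) bond. [cite: Balaban1984PropagatorsII, (2.19)–(2.20) p.226] -/
theorem wLevel_oneLevel {P : Params} {k : ℕ} (hk : k + 1 ≤ P.m + P.K) (a : ℝ)
    (p : BondIdx (twoScale k hk (∅ : Finset (Site P (k + 1))))) :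
    wLevel P k (a * ((P.L : ℝ) ^ k) ^ P.d) p = a * ((P.L : ℝ) ^ k) ^ P.d := by
  unfold wLevel
  rw [if_pos (bondIdx_twoScale_empty_level hk p)]

/-- **HONESTY LINK — `G` of the one-level member IS p09's kernel `Gk = Re Δ_a⁻¹` of [4] (1.71)**: `(GJ)(b) = Σ_{b′} G_k(b, b′) J(b′)` (p22's
`G_eq_GE`, then file (B) `GE_twoScale_empty_apply_eq_sum_Gk`). [cite: Balaban1984PropagatorsII, (2.90) p.239 + (2.22) p.226] -/
theorem oneLevelData_G_apply_eq_sum_Gk (P : Params) {k : ℕ} (hk : k + 1 ≤ P.m + P.K) {a : ℝ} (ha : 0 < a) (J : BondSpace P) (b : PBond P 0) :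
    (oneLevelData P k a).G J b = ∑ b' : PBond P 0, Gk (Nat.le_of_succ_le hk) a (b.src, b.dir) (b'.src, b'.dir) * J b' := by
  have hG := G_eq_GE (pow_ne_zero k (Nat.cast_ne_zero.2 P.L_pos.ne')) hk (∅ : Finset (Site P (k + 1))) (a := a * ((P.L : ℝ) ^ k) ^ P.d) (weight_pos P k ha)
  unfold oneLevelData
  rw [hG]
  exact GE_twoScale_empty_apply_eq_sum_Gk hk (wLevel_pos (j := k) (weight_pos P k ha)) ha (wLevel_oneLevel hk a) J b

/-- the same with the kernel written as the `G`-field of p09's Sect. 7.2 torus representation `torusRep P k (deltaAData hk a)` (definitionally `Gk`) —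
the object whose [4]-functionals `settingOf` p19's Prop. 1.2 bridge grades. [cite: Balaban1984PropagatorsII, Prop. 2.5 p.246] -/
theorem oneLevelData_G_apply_eq_sum_torusRep_G (P : Params) {k : ℕ} (hk : k + 1 ≤ P.m + P.K) {a : ℝ} (ha : 0 < a) (J : BondSpace P)
    (b : PBond P 0) :
    (oneLevelData P k a).G J b
      = ∑ b' : PBond P 0, (torusRep P k (deltaAData (Nat.le_of_succ_le hk) a)).G (b.src, b.dir) (b'.src, b'.dir) * J b' :=
  oneLevelData_G_apply_eq_sum_Gk P hk ha J b

/-! ## §2  The one-level family and Proposition 2.5 for it -/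

/-- **the index of the one-level sub-family**: all tori of the `Setup` calculus with `d`, `L` fixed (`P : Params`) and a level `k` with `1 ≤ k`,
`k + 1 ≤ m + K` (the sub-family of p19's all-tori index with the coarsest level dropped). [cite: Balaban1984PropagatorsII, Prop. 2.5 p.246] -/
def Idx (d L : ℕ) : Type := {x : Params × ℕ // x.1.d = d ∧ x.1.L = L ∧ 1 ≤ x.2 ∧ x.2 + 1 ≤ x.1.m + x.1.K}

/-- the inclusion into p19's all-tori index. [cite: Balaban1984PropagatorsII, Prop. 2.5 p.246] -/
def toAllTori {d L : ℕ} (i : Idx d L) : {x : Params × ℕ // x.1.d = d ∧ x.1.L = L ∧ 1 ≤ x.2 ∧ x.2 ≤ x.1.m + x.1.K} :=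
  ⟨i.1, i.2.1, i.2.2.1, i.2.2.2.1, Nat.le_of_succ_le i.2.2.2.2⟩

/-- **the one-level family of local operators `G_□`** as `B6.LocalOp`s: functionals `S` = p09/p19's [4]-setting of `G = Δ_a⁻¹` on the torus
(`settingOf (torusRep P k (deltaAData hk a)) k`), representation field = the (2.129) identity for `oneLevelData` — THE SAME operator (§1).
[cite: Balaban1984PropagatorsII, Prop. 2.5 p.246] -/
def loc (d L : ℕ) (a : ℝ) (i : Idx d L) : B6.LocalOp where
  S := settingOf (torusRep i.1.1 i.1.2 (deltaAData (Nat.le_of_succ_le i.2.2.2.2) a)) i.1.2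
  Repr2129 := ∀ J : BondSpace i.1.1,
    ⟪J, (oneLevelData i.1.1 i.1.2 a).G J⟫_ℝ = ⟪J, (oneLevelData i.1.1 i.1.2 a).K1 J⟫_ℝ +
      ⟪J - (oneLevelData i.1.1 i.1.2 a).K2 J, ((oneLevelData i.1.1 i.1.2 a).Gt +
        (oneLevelData i.1.1 i.1.2 a).Hj ∘ₗ (oneLevelData i.1.1 i.1.2 a).Ct ∘ₗ LinearMap.adjoint (oneLevelData i.1.1 i.1.2 a).Hj)
        (J - (oneLevelData i.1.1 i.1.2 a).K2 J)⟫_ℝ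

-- `maxRecDepth`: matching the field against p22's `eq2129_V1` unfolds the (large) structure term `tsV1 …` behind `oneLevelData`;
-- the unification is definitional (δ-reduction of `oneLevelData` only) but deep.
set_option maxRecDepth 65536 in
/-- **(2.129) holds for every member** — the `Repr2129` field of `loc i` is p22's theorem `eq2129_V1` for `oneLevelData` (any `Λ′`, here `∅`;
hypotheses `c ≠ 0`, `k + 1 ≤ m + K`, positive weights — all met by the index). [cite: Balaban1984PropagatorsII, (2.129) p.246] -/
theorem repr2129_loc (d L : ℕ) {a : ℝ} (ha : 0 < a) (i : Idx d L) : (loc d L a i).Repr2129 := by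
  intro J
  exact eq2129_V1 (pow_ne_zero i.1.2 (Nat.cast_ne_zero.2 i.1.1.L_pos.ne')) i.2.2.2.2 (∅ : Finset (Site i.1.1 (i.1.2 + 1)))
    (wPrinted_pos i.1.2 ∅ (weight_pos i.1.1 i.1.2 ha)) J

/-- unfolding: the setting of `loc i` is p19's all-tori family member at `toAllTori i`. [cite: Balaban1984PropagatorsII, Prop. 2.5 p.246] -/
theorem loc_S (d L : ℕ) (a : ℝ) (i : Idx d L) :
    (loc d L a i).S = settingOf (torusRep (toAllTori i).1.1 (toAllTori i).1.2 (deltaAData (toAllTori i).2.2.2.2 a)) (toAllTori i).1.2 := rfl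

/-- **the [4] half of Prop. 2.5 for the one-level family** — p19's `prop12Printed_allTori`, reindexed. [cite: Balaban1984PropagatorsII, Prop. 2.5 p.246] -/
theorem prop12Printed_loc (d L : ℕ) {a : ℝ} (ha : 0 < a) : B5.Prop12Printed (fun i : Idx d L => (loc d L a i).S) := by
  obtain ⟨δ₀, C, Cα, Cε, Cαε, hδ, hC, h⟩ := prop12Printed_allTori d L ha
  exact ⟨δ₀, C, Cα, Cε, Cαε, hδ, hC, fun i => h (toAllTori i)⟩

/-- **PROPOSITION 2.5 ON THE ONE-LEVEL FAMILY, NO HYPOTHESIS**: the verbatim census Prop `B6.Prop25Printed` inhabited — (2.129) for every member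
(p22) ∧ the inequalities (1.110)–(1.114) of [4] Prop. 1.2 with one `(δ₂, O(1), O(1)(α), O(1)(ε), O(1)(α,ε))` for all members (p19, from r02/p37's
torus Prop. 1.2), both about ONE operator (§1). [cite: Balaban1984PropagatorsII, Prop. 2.5 p.246] -/
theorem prop25Printed_oneLevel (d L : ℕ) {a : ℝ} (ha : 0 < a) : B6.Prop25Printed (loc d L a) :=
  ⟨fun i => repr2129_loc d L ha i, prop12Printed_loc d L ha⟩

/-- the DAG edge of record `B6.prop12Shape_of_prop25` applied: the inequality half IS [4] Prop. 1.2 for the settings. [cite: Balaban1984PropagatorsII, Prop. 2.5 p.246] -/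
theorem prop12_of_prop25_oneLevel (d L : ℕ) {a : ℝ} (ha : 0 < a) : B5.Prop12Printed (fun i : Idx d L => (loc d L a i).S) :=
  B6.prop12Shape_of_prop25 _ (prop25Printed_oneLevel d L ha)

/-- non-vacuity of the index: any `P : Params` with `m + K ≥ 2` gives a member at level `1`. [cite: Balaban1984PropagatorsII, Prop. 2.5 p.246] -/
theorem idx_nonempty (P : Params) (h : 2 ≤ P.m + P.K) : Nonempty (Idx P.d P.L) :=
  ⟨⟨(P, 1), rfl, rfl, le_rfl, h⟩⟩

end Literature.MathematicalPhysics.QuantumFieldTheory.Balaban1983to89.B6Prop25OneLevelV1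

end
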